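import Literature.NumberTheory.LFunctions.CriticalZerosDirichletFamily
import HarnessLib

/-!
# Sono (2025), Theorem 1.1: at least `61.07%` critical and `60.44%` simple critical zeros on average
# over the family of even primitive Dirichlet characters of conductor `q ≍ Q`

LABEL (cell `landau-siegel`, §C literature harvest, topic r5; bears_on F-S3 §C, §B-len START-HERE):
the numerical record of Levinson's method WITH a mollifier of length `Q^θ` for every `θ < 1` — the
`θ < 1` side of the knife edge E*-len, on average over `χ` and `q`; Feng's multi-piece mollifier on
the Conrey–Iwaniec–Soundararajan mean-value theorem. No claim about a single modulus or about
exceptional characters. «The programme SEARCHES and TYPES; no claim about Landau–Siegel zeros,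
Theorems 1–2 of arXiv:2211.02515 or a repaired Margin232 until a kernel theorem says so.»

Topic `Literature/NumberTheory/LFunctions` (namespace `Literature.NumberTheory.LFunctions`; the
paper's counting functions in the sub-namespace `SonoCriticalZeros`), continuing
`CriticalZerosDirichletFamily.lean` (Conrey–Iwaniec–Soundararajan 2013: `56%`, and the mean-value
Theorem 2 that this paper uses in the form of its Theorem 1.2 = [CIS3]) whose zero vocabulary is
CITED (`ExplicitPsiChar.charNontrivialZeros χ`, multiplicity `DirichletDisc.zeroOrder χ ρ`), not
re-declared. STATEMENT LAYER (D-0014): ONE named fact (Theorem 1.1, both displays) over honest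
definitions of the paper's DYADIC counts (`T ≤ γ < 2T`, which differ from CIS's `|γ| ≤ T`) and of its
even-character family sum `𝒩(T,Q) = Σ_q W(q/Q) Σ♭_{χ (mod q)} N(T,χ)` (no `φ(q)⁻¹`).

## What the source prints (held text `paper:arxiv-2105.07422`, corpus-tex chunks p0002–p0004, read
## 2026-08-26)

K. Sono, *Zeros of Dirichlet L-functions on the critical line*, J. Number Theory **271** (2025)
348–388 = arXiv:2105.07422 [Sono2025].

§1 (p0003): «Let `q` be a positive integer and `χ` be an even primitive character modulo `q` … For
`T > 0`, we denote the number of zeros `ρ = β + iγ` of the Dirichlet L-function `L(s,χ)` with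
`0 < β < 1`, `T ≤ γ < 2T` by `N(T,χ)` … We denote the number of these zeros with `β = 1/2` by
`N₀(T,χ)`, and denote by `N₀′(T,χ)` the number of simple zeros counted by `N₀(T,χ)`. … Let `W(x)` be
a smooth function compactly supported on `[1,2]`. For `Q, T ≥ 3`, put
`𝒩(T,Q) = Σ_q W(q/Q) Σ♭_{χ (mod q)} N(T,χ)`   (1.5),
where the subscript `♭` means that the summation is restricted to even primitive characters. We also
define `𝒩₀(T,Q)` and `𝒩₀′(T,Q)` by replacing `N(T,χ)` in (1.5) with `N₀(T,χ)`, `N₀′(T,χ)`,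
respectively.»

> **Theorem 1.1.** For `(log Q)² ≤ T ≤ (log Q)^A`, we have
> `𝒩₀′(T,Q) ≥ 0.6044 · 𝒩(T,Q)`,   `𝒩₀(T,Q) ≥ 0.6107 · 𝒩(T,Q)`,
> where `A > 2` is any constant, provided `Q` is sufficiently large in terms of `A`.

(Abstract: «Using Feng's mollifier and an asymptotic formula for the mean square of Dirichlet
L-functions introduced in [CIS3], we prove that averaged over primitive characters and conductors, at
least 61.07% of zeros of Dirichlet L-functions are on the critical line, and at least 60.44% of zeros
are simple and on the critical line. These results improve the work of Conrey, Iwaniec and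
Soundararajan [CIS2].» §1 also records: «[CIS] mentioned without proof that by using Feng's mollifier
instead of Levinson's, one can improve the results of [CIS2] and obtain `𝒩₀(T,Q) ≥ (3/5)𝒩(T,Q)`. The
value 3/5 is close to the lower bound for the proportion of critical zeros of the Riemann
zeta-function assuming the so-called `θ = 1` conjecture. The main purpose of this paper is to establish
a complete proof.» Theorem 1.3 — the CONDITIONAL extension to heights `T ≍ Q^η` with a decreasing
proportion `C(η)`, negative for `η > 5.074` — is not typed.)

## Lean rendering / design choices (audit notes for ls-lit-ref)

* Zeros and multiplicities: the tree's `ExplicitPsiChar.charNontrivialZeros χ` and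
  `DirichletDisc.zeroOrder χ ρ` (as in `CriticalZerosDirichletFamily.lean`); "counted by `N`" is read
  WITH multiplicity for `N` and `N₀` (standard; the paper says "the number of zeros"), while `N₀′`
  counts simple zeros (multiplicity one) once each.
* Height window `T ≤ γ < 2T` verbatim (`Set.Ico`-type condition on `Im ρ`).
* `W`: smooth, compactly supported in `[1,2]` as printed, and NON-NEGATIVE (implicit in the paper —
  the displays are lower bounds for weighted counts; recorded as a hypothesis). The `q`-sum is a
  `finsum` over `q = k + 1 ≥ 1`, finite because `W(q/Q) = 0` unless `Q ≤ q ≤ 2Q`.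
* "`(log Q)² ≤ T ≤ (log Q)^A`, `A > 2` any constant, `Q` sufficiently large in terms of `A`" ⟹
  `∀ W, ∀ A > 2, ∃ Q₀, ∀ Q ≥ Q₀, ∀ T` in the window (the threshold may also depend on `W`, which is
  fixed data of the family — made explicit by the quantifier order).
* The constants `0.6044`, `0.6107` are the printed outcomes of a floating-point optimisation (Feng
  mollifier, `θ → 1⁻`); they are typed verbatim and NOT certified here.

## References

* K. Sono, J. Number Theory 271 (2025) 348–388, arXiv:2105.07422: §1 (1.5), Theorem 1.1;
  Theorems 1.2–1.3. [Sono2025]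
* J. B. Conrey, H. Iwaniec, K. Soundararajan, *Critical zeros of Dirichlet L-functions*, J. reine
  angew. Math. 681 (2013) 175–198 — tree: `CriticalZerosDirichletFamily.lean`.
  [ConreyIwaniecSoundararajan2011CriticalZeros]
-/

noncomputable section

open scoped Classical ContDiff
open Complex Finset Filter Set

namespace Literature.NumberTheory.LFunctions

namespace SonoCriticalZeros

section OneCharacter

variable {q : ℕ} [NeZero q]

/-- `N(T,χ)` of Sono §1: the number of zeros `ρ = β + iγ` of `L(s,χ)` with `0 < β < 1` and
`T ≤ γ < 2T`, counted with multiplicity (`finsum` of `DirichletDisc.zeroOrder χ ρ` over the tree's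
non-trivial zeros in the dyadic window). [cite: Sono2025, §1 (definition of N(T,χ))] -/
def zeroCount (χ : DirichletCharacter ℂ q) (T : ℝ) : ℕ :=
  ∑ᶠ ρ ∈ {ρ : ℂ | ρ ∈ ExplicitPsiChar.charNontrivialZeros χ ∧ T ≤ ρ.im ∧ ρ.im < 2 * T},
    DirichletDisc.zeroOrder χ ρ

/-- `N₀(T,χ)`: the zeros counted by `N(T,χ)` with `β = ½` (with multiplicity).
[cite: Sono2025, §1 (definition of N₀(T,χ))] -/
def criticalZeroCount (χ : DirichletCharacter ℂ q) (T : ℝ) : ℕ :=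
  ∑ᶠ ρ ∈ {ρ : ℂ | ρ ∈ ExplicitPsiChar.charNontrivialZeros χ ∧ ρ.re = 1 / 2 ∧ T ≤ ρ.im ∧
      ρ.im < 2 * T}, DirichletDisc.zeroOrder χ ρ

/-- `N₀′(T,χ)`: the number of SIMPLE zeros `½ + iγ`, `T ≤ γ < 2T` (multiplicity one, each counted
once). [cite: Sono2025, §1 (definition of N₀′(T,χ))] -/
def simpleCriticalZeroCount (χ : DirichletCharacter ℂ q) (T : ℝ) : ℕ :=
  Set.ncard {ρ : ℂ | ρ ∈ ExplicitPsiChar.charNontrivialZeros χ ∧ ρ.re = 1 / 2 ∧ T ≤ ρ.im ∧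
    ρ.im < 2 * T ∧ DirichletDisc.zeroOrder χ ρ = 1}

/-- The simple critical zeros in the window are among the critical zeros in the window, which are
among all zeros in the window (so `N₀′ ≤ N₀ ≤ N` termwise). [cite: Sono2025, §1 (definitions)] -/
theorem simpleCriticalZeros_subset (χ : DirichletCharacter ℂ q) (T : ℝ) :
    {ρ : ℂ | ρ ∈ ExplicitPsiChar.charNontrivialZeros χ ∧ ρ.re = 1 / 2 ∧ T ≤ ρ.im ∧
        ρ.im < 2 * T ∧ DirichletDisc.zeroOrder χ ρ = 1} ⊆
      {ρ : ℂ | ρ ∈ ExplicitPsiChar.charNontrivialZeros χ ∧ ρ.re = 1 / 2 ∧ T ≤ ρ.im ∧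
        ρ.im < 2 * T} ∧
    {ρ : ℂ | ρ ∈ ExplicitPsiChar.charNontrivialZeros χ ∧ ρ.re = 1 / 2 ∧ T ≤ ρ.im ∧
        ρ.im < 2 * T} ⊆
      {ρ : ℂ | ρ ∈ ExplicitPsiChar.charNontrivialZeros χ ∧ T ≤ ρ.im ∧ ρ.im < 2 * T} :=
  ⟨fun _ h ↦ ⟨h.1, h.2.1, h.2.2.1, h.2.2.2.1⟩, fun _ h ↦ ⟨h.1, h.2.2.1, h.2.2.2⟩⟩

end OneCharacter

/-! ### The even-character family (1.5) -/

/-- Sono's weights: «`W(x)` a smooth function compactly supported on `[1,2]`», taken NON-NEGATIVE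
(implicit in the printed lower bounds). [cite: Sono2025, §1 (before (1.5))] -/
def IsSonoWeight (W : ℝ → ℝ) : Prop :=
  ContDiff ℝ ∞ W ∧ (∀ x, 0 ≤ W x) ∧ tsupport W ⊆ Set.Icc 1 2

/-- The family sum (1.5) with a general statistic `f` in place of `N(T,χ)`:
`Σ_q W(q/Q) Σ♭_{χ (mod q)} f(χ)`, `♭` = even primitive characters (the `q`-sum as a `finsum` over
`q = k + 1`, the statistic indexed by `k` so that the modulus `k + 1` is visibly non-zero).
[cite: Sono2025, §1 (1.5)] -/
def evenFamilySum (W : ℝ → ℝ) (Q : ℝ) (f : (k : ℕ) → DirichletCharacter ℂ (k + 1) → ℝ) : ℝ :=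
  ∑ᶠ k : ℕ, W (((k + 1 : ℕ) : ℝ) / Q) *
    ∑ χ : DirichletCharacter ℂ (k + 1) with (χ.IsPrimitive ∧ χ.Even), f k χ

/-- `𝒩(T,Q) = Σ_q W(q/Q) Σ♭_χ N(T,χ)` (1.5). [cite: Sono2025, §1 (1.5)] -/
def familyZeroCount (W : ℝ → ℝ) (Q T : ℝ) : ℝ :=
  evenFamilySum W Q fun _ χ ↦ (zeroCount χ T : ℝ)

/-- `𝒩₀(T,Q)`: (1.5) with `N₀(T,χ)`. [cite: Sono2025, §1 (after (1.5))] -/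
def familyCriticalZeroCount (W : ℝ → ℝ) (Q T : ℝ) : ℝ :=
  evenFamilySum W Q fun _ χ ↦ (criticalZeroCount χ T : ℝ)

/-- `𝒩₀′(T,Q)`: (1.5) with `N₀′(T,χ)`. [cite: Sono2025, §1 (after (1.5))] -/
def familySimpleCriticalZeroCount (W : ℝ → ℝ) (Q T : ℝ) : ℝ :=
  evenFamilySum W Q fun _ χ ↦ (simpleCriticalZeroCount χ T : ℝ)

/-- Unfolding lemma: the three family counts are the family sum of the three statistics.
[cite: Sono2025, §1 (1.5)] -/
theorem familyZeroCount_def (W : ℝ → ℝ) (Q T : ℝ) :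
    familyZeroCount W Q T = evenFamilySum W Q (fun _ χ ↦ (zeroCount χ T : ℝ)) ∧
    familyCriticalZeroCount W Q T = evenFamilySum W Q (fun _ χ ↦ (criticalZeroCount χ T : ℝ)) ∧
    familySimpleCriticalZeroCount W Q T =
      evenFamilySum W Q (fun _ χ ↦ (simpleCriticalZeroCount χ T : ℝ)) :=
  ⟨rfl, rfl, rfl⟩

end SonoCriticalZeros

open SonoCriticalZeros

/-- **Sono 2025, Theorem 1.1** (Levinson's method with Feng's mollifier of length `Q^θ`, any
`θ < 1`, on the Conrey–Iwaniec–Soundararajan mean-value theorem; numerics not certified here). For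
every non-negative smooth `W` supported in `[1,2]` and every constant `A > 2` there is `Q₀` such that
for all `Q ≥ Q₀` and all `T` with `(log Q)² ≤ T ≤ (log Q)^A`:
`𝒩₀′(T,Q) ≥ 0.6044 · 𝒩(T,Q)` and `𝒩₀(T,Q) ≥ 0.6107 · 𝒩(T,Q)`
— on average over even primitive `χ (mod q)`, `q ≍ Q`, at least `60.44%` of the zeros of `L(s,χ)` at
height `T ≤ γ < 2T` are simple and critical and at least `61.07%` are critical. Status:
theorem-in-print (named fact). [cite: Sono2025, Theorem 1.1] -/
def sono2025_theorem11 : Prop :=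
  ∀ W : ℝ → ℝ, IsSonoWeight W → ∀ A : ℝ, 2 < A →
    ∃ Q₀ : ℝ, ∀ Q T : ℝ, Q₀ ≤ Q → Real.log Q ^ (2 : ℝ) ≤ T → T ≤ Real.log Q ^ A →
      (0.6044 : ℝ) * familyZeroCount W Q T ≤ familySimpleCriticalZeroCount W Q T ∧
      (0.6107 : ℝ) * familyZeroCount W Q T ≤ familyCriticalZeroCount W Q T

end Literature.NumberTheory.LFunctions
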